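import Summits.BirchSwinnertonDyer.BirchSwinnertonDyer.Theorems.KolyvaginDepthDoorKNSupplyExactReadingZhang
import HarnessLib

/-!
# Route `KolyvaginDepthDoor`, crux `KolyvaginDepthSupplyKN` (stmt-BirchSwinnertonDyer-22820) —
# THE RANK-2 ROW READ FROM TWO KNOWN POINTS ONLY («points first»): with `2 ≤ rank E(ℚ)` from a kernel
# point certificate, the bit `↔` «`rank E(ℚ) = 2` ∧ `Ш(E/ℚ)[p] = 0` ∧ `#Sel_p(E^{(d_K)}/ℚ) ≤ p`»

Helper file of the lead prover of line `levelone` (kdd-p1 g14; `--supports stmt-BirchSwinnertonDyer-22820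
--as helper`); it closes nothing and BSD is not proved by it.

The rank-2 row readings (`…_of_rank_two_of_maninPrint`, file `KolyvaginDepthDoorKNSupplyExactReadingDepthRow`;
`…_of_rank_two_of_lemma84`, file `KolyvaginDepthDoorKNSupplyExactReadingZhang`) assume `rank E(ℚ) = 2`
— for a census curve, the Rank2Observatory's general 2-descent. The depth door itself needs only the
LOWER bound («points first»: two independent points, the tree's kernel point certificates
`Rank2ObservatoryKernelCerts*.C<label>.two_le_rank`) and PINS the rank. This file states the rows in that
currency, so that per-curve instances need no 2-descent:

* `kolyvaginClass_prime_ne_zero_iff_rankTwo_shaTrivial_twistSelmer_of_maninPrint` — Kodaira–Néron cell,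
  `p` split, `d_K` odd (supply: Castella–Sano ∘ Zanarella ∘ Howard–Zanarella, frame from modularity +
  Mazur); given `2 ≤ rank E`: «∃ frame, Kolyvagin prime `ℓ`, datum: `c_1(ℓ) ≠ 0`» `↔`
  «`rank E = 2` ∧ `Ш(E)[p] = 0` ∧ `#Sel_p(E^{(d_K)}) ≤ p`».
* `kolyvaginClass_prime_ne_zero_iff_rankTwo_shaTrivial_twistSelmer_of_lemma84` — W. Zhang's ♠ cell,
  `p ∤ d_K` inert or split (supply: Lemma 8.4 (1) / Thm. 9.1 by name); same statement.

Reading: at a depth-table row with two certified points, ONE computed class `c_1(ℓ) ≠ 0` is EXACTLY the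
conjunction «`rank E(ℚ) = 2`, `Ш(E/ℚ)[p] = 0`, `dim Sel_p(E^{(d_K)}/ℚ) ≤ 1`» (modulo (γ) + the supply
facts): the 2-descent upper bound, the `p`-part of `Ш(E)` and the twist's `p`-Selmer bound all at once.
CONDITIONAL on the named facts; per `(E, p, K)`; BSD is NOT proved by any of this.

References: [Kolyvagin1991MathAnn] Thm. 2.3; [GrossLMS1991] Prop. 3.7 (2); [CastellaSano2026] Thm. 3;
[WZhang2014] Lemma 8.4 (1); [JetchevLauterStein2009] §3.6 (arXiv:0707.0032).
-/

set_option linter.dupNamespace false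

noncomputable section

open scoped Classical NumberField

namespace Summit.BirchSwinnertonDyer.BirchSwinnertonDyer.Theorems.KolyvaginDepthDoor

open Literature.NumberTheory.EllipticCurves Literature.NumberTheory.EllipticCurves.ModularForms
  WeierstrassCurve NumberField IsDedekindDomain
open Summit.BirchSwinnertonDyer.BirchSwinnertonDyer.Theorems

/-- **The rank is pinned by the bit ((γ) only).** On the Kodaira–Néron cell, a datum of prime conductor
`ℓ` with `c_1(ℓ) ≠ 0` and two independent points give `rank E(ℚ) = 2` (first-sign door of a datum).
[cite: Kolyvagin1991MathAnn, Thm. 2.3] [cite: GrossLMS1991, Prop. 3.7 (2)] -/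
theorem rank_eq_two_of_kolyvaginClass_prime_ne_zero
    (h372 : GrossLMS1991.prop37_2_frobeniusCongruence)
    (W : WeierstrassCurve ℚ) [W.IsElliptic] [W.IsGloballyMinimal] (hcm : ¬ W.HasCM)
    (hr : 2 ≤ W.mordellWeilRank)
    (p : ℕ) [hp : Fact p.Prime] (h5 : 5 ≤ p)
    (htower : ∀ n : ℕ, W.HasSurjectiveModNGaloisRep (p ^ n : ℕ))
    (hKN : ∀ v : HeightOneSpectrum (𝓞 ℚ), W.HasMultiplicativeReductionAt v →
      ¬ p ∣ W.ordMinimalDiscriminant v)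
    (K : Type) [Field K] [NumberField K] (hK : IsImaginaryQuadratic K)
    (hD3 : NumberField.discr K ≠ -3) (hD4 : NumberField.discr K ≠ -4)
    [NeZero (W.conductorNorm ℤ)] (hH : SatisfiesHeegnerHypothesis (W.conductorNorm ℤ) K)
    {Dt : ModularParametrizationData W (W.conductorNorm ℤ)} {β : ℤ} {ι : K →+* ℂ} {ℓ : ℕ}
    (hℓ : ℓ.Prime) (hkol : Zhang2014.IsKolyvaginPrime (W.conductorNorm ℤ) W K p ℓ)
    (d : KolyvaginHeegnerData Dt β ι ℓ) (hne : d.kolyvaginClass hp.out 1 ≠ 0) :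
    W.mordellWeilRank = 2 := by
  have hp2 : p ≠ 2 := by omega
  have hadd : ∀ v : HeightOneSpectrum (𝓞 ℚ), W.HasAdditiveReductionAt v → p ≠ 3 ∨
      (W.kodairaSymbolAt v ≠ Literature.NumberTheory.DiophantineGeometry.KodairaSymbol.IV ∧
        W.kodairaSymbolAt v ≠ Literature.NumberTheory.DiophantineGeometry.KodairaSymbol.IVstar) :=
    fun _ _ ↦ Or.inl (by omega)
  obtain ⟨c, hc, hcc⟩ := exists_conj_of_isImaginaryQuadratic K hK
  have hk : ∀ q ∈ ℓ.primeFactors, Zhang2014.IsKolyvaginPrime (W.conductorNorm ℤ) W K p q := by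
    intro q hq
    rw [hℓ.primeFactors, Finset.mem_singleton] at hq
    exact hq ▸ hkol
  have hrank : ℓ.primeFactors.card + 1 ≤ W.mordellWeilRank := by
    rw [hℓ.primeFactors, Finset.card_singleton]; exact hr
  obtain ⟨-, hr2, -⟩ :=
    shaCorank_eq_zero_of_kolyvaginClass_ne_zero_of_rank_le_of_datum_kodairaNeron h372 hcm hK hD3 hD4 hH
      p hp2 htower c hc hcc hKN hadd hℓ.squarefree hk d hne hrank
  rw [hr2, hℓ.primeFactors, Finset.card_singleton]

/-- **THE RANK-2 ROW FROM TWO KNOWN POINTS, Kodaira–Néron cell with `p` split (modulo (γ) and five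
print facts by name).** Given `2 ≤ rank E(ℚ)` (two independent points): «∃ frame, Kolyvagin prime `ℓ`,
datum: `c_1(ℓ) ≠ 0`» `↔` «`rank E(ℚ) = 2` ∧ `Ш(E/ℚ)[p] = 0` ∧ `#Sel_p(E^{(d_K)}/ℚ) ≤ p`». The bit pins
the rank (door), and with the rank pinned the row is `…_of_rank_two_of_maninPrint`. CONDITIONAL on the
named facts; per curve; BSD is not proved by it. [cite: GrossLMS1991, Prop. 3.7 (2)]
[cite: CastellaSano2026, Thm. 3] [cite: Zanarella2019, Prop. 2.18] [cite: Howard2004, Lemma 1.6.4]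
[cite: Mazur1978, Cor. 4.1] [cite: JetchevLauterStein2009, §3.6 (arXiv:0707.0032)] -/
theorem kolyvaginClass_prime_ne_zero_iff_rankTwo_shaTrivial_twistSelmer_of_maninPrint
    (h372 : GrossLMS1991.prop37_2_frobeniusCongruence)
    (h3 : Literature.NumberTheory.EllipticCurves.CastellaSano2026_kolyvaginClass_selmerDivisibility_eq_padicValNat_tamagawaProduct)
    (hZ : Literature.NumberTheory.EllipticCurves.Zanarella2019_kolyvaginClass_one_ne_zero_of_not_selmerDivisible)
    (hHZ : Literature.NumberTheory.EllipticCurves.HowardZanarella_exists_minimal_kolyvaginClass_one_selmerCard_of_ne_zero)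
    (hnf : exists_isNewformOf) (hMaz : mazur_not_dvd_maninConstant_of_odd)
    (W : WeierstrassCurve ℚ) [W.IsElliptic] [W.IsGloballyMinimal] (hcm : ¬ W.HasCM)
    (hr : 2 ≤ W.mordellWeilRank)
    (p : ℕ) [hp : Fact p.Prime] (h5 : 5 ≤ p) (hgood : W.HasGoodReductionAtPrime p)
    (hord : ¬ (p : ℤ) ∣ W.frobeniusTrace p)
    (htower : ∀ n : ℕ, W.HasSurjectiveModNGaloisRep (p ^ n : ℕ))
    (hKN : ∀ v : HeightOneSpectrum (𝓞 ℚ), W.HasMultiplicativeReductionAt v →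
      ¬ p ∣ W.ordMinimalDiscriminant v)
    (K : Type) [Field K] [NumberField K] (hK : IsImaginaryQuadratic K)
    (hodd : Odd (NumberField.discr K)) (hD3 : NumberField.discr K ≠ -3) (hD4 : NumberField.discr K ≠ -4)
    (hpD : ¬ ((p : ℤ) ∣ NumberField.discr K)) (hspl : SatisfiesHeegnerHypothesis p K)
    [NeZero (W.conductorNorm ℤ)] (hH : SatisfiesHeegnerHypothesis (W.conductorNorm ℤ) K) :
    (∃ (Dt : ModularParametrizationData W (W.conductorNorm ℤ)) (β : ℤ) (ι : K →+* ℂ) (ℓ : ℕ)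
      (d : KolyvaginHeegnerData Dt β ι ℓ),
      ℓ.Prime ∧ Zhang2014.IsKolyvaginPrime (W.conductorNorm ℤ) W K p ℓ ∧
        d.kolyvaginClass hp.out 1 ≠ 0) ↔
    (W.mordellWeilRank = 2 ∧
      (W.sha ⊓ AddSubgroup.torsionBy W.galH1 (p : ℤ) : AddSubgroup W.galH1) = ⊥ ∧
      Nat.card ((W.quadraticTwist (NumberField.discr K : ℚ)).selmerGroup p) ≤ p) := by
  constructor
  · rintro ⟨Dt, β, ι, ℓ, d, hℓ, hkol, hne⟩
    have hr2 := rank_eq_two_of_kolyvaginClass_prime_ne_zero h372 W hcm hr p h5 htower hKN K hK hD3 hD4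
      hH hℓ hkol d hne
    exact ⟨hr2, (kolyvaginClass_prime_ne_zero_iff_shaTrivial_twistSelmer_of_rank_two_of_maninPrint h372
      h3 hZ hHZ hnf hMaz W hcm hr2 p h5 hgood hord htower hKN K hK hodd hD3 hD4 hpD hspl hH).mp
        ⟨Dt, β, ι, ℓ, d, hℓ, hkol, hne⟩⟩
  · rintro ⟨hr2, hsha, hSel⟩
    exact (kolyvaginClass_prime_ne_zero_iff_shaTrivial_twistSelmer_of_rank_two_of_maninPrint h372 h3 hZ
      hHZ hnf hMaz W hcm hr2 p h5 hgood hord htower hKN K hK hodd hD3 hD4 hpD hspl hH).mpr ⟨hsha, hSel⟩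

/-- **THE RANK-2 ROW FROM TWO KNOWN POINTS, W. Zhang's ♠ cell, `p ∤ d_K` inert or split (modulo (γ)
and W. Zhang's Lemma 8.4 (1) / Thm. 9.1 by name).** Given `2 ≤ rank E(ℚ)`: «∃ frame, Kolyvagin prime
`ℓ`, datum: `c_1(ℓ) ≠ 0`» `↔` «`rank E(ℚ) = 2` ∧ `Ш(E/ℚ)[p] = 0` ∧ `#Sel_p(E^{(d_K)}/ℚ) ≤ p`».
CONDITIONAL on the two named facts; per curve; BSD is not proved by it.
[cite: WZhang2014, Lemma 8.4 (1) (p. 236), Thm. 9.1 (p. 240)] [cite: GrossLMS1991, Prop. 3.7 (2)]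
[cite: JetchevLauterStein2009, §3.6 (arXiv:0707.0032)] -/
theorem kolyvaginClass_prime_ne_zero_iff_rankTwo_shaTrivial_twistSelmer_of_lemma84
    (h372 : GrossLMS1991.prop37_2_frobeniusCongruence)
    (h84 : Literature.NumberTheory.EllipticCurves.WZhang2014_lemma84_exists_minimal_kolyvaginClass_one_selmerCard)
    (W : WeierstrassCurve ℚ) [W.IsElliptic] [W.IsGloballyMinimal] (hcm : ¬ W.HasCM)
    (hr : 2 ≤ W.mordellWeilRank)
    (p : ℕ) [hp : Fact p.Prime] (h5 : 5 ≤ p) (hgood : W.HasGoodReductionAtPrime p)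
    (hord : ¬ (p : ℤ) ∣ W.frobeniusTrace p)
    (htower : ∀ n : ℕ, W.HasSurjectiveModNGaloisRep (p ^ n : ℕ))
    (hKN : ∀ v : HeightOneSpectrum (𝓞 ℚ), W.HasMultiplicativeReductionAt v →
      ¬ p ∣ W.ordMinimalDiscriminant v)
    (hS1 : ∀ (ℓ : ℕ) [Fact ℓ.Prime], W.HasMultiplicativeReductionAtPrime ℓ →
      ¬ p ∣ padicValInt ℓ W.minimalDiscriminantInt)
    (hS2 : ¬ Squarefree (W.conductorNorm ℤ) →
      (∃ (ℓ : ℕ) (_ : Fact ℓ.Prime), W.HasMultiplicativeReductionAtPrime ℓ ∧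
          ¬ p ∣ padicValInt ℓ W.minimalDiscriminantInt) ∧
        ∃ (ℓ₁ ℓ₂ : ℕ) (_ : Fact ℓ₁.Prime) (_ : Fact ℓ₂.Prime), ℓ₁ ≠ ℓ₂ ∧
          W.HasMultiplicativeReductionAtPrime ℓ₁ ∧ W.HasMultiplicativeReductionAtPrime ℓ₂)
    (K : Type) [Field K] [NumberField K] (hK : IsImaginaryQuadratic K)
    (hD3 : NumberField.discr K ≠ -3) (hD4 : NumberField.discr K ≠ -4)
    (hpD : ¬ ((p : ℤ) ∣ NumberField.discr K))
    [NeZero (W.conductorNorm ℤ)] (hH : SatisfiesHeegnerHypothesis (W.conductorNorm ℤ) K) :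
    (∃ (Dt : ModularParametrizationData W (W.conductorNorm ℤ)) (β : ℤ) (ι : K →+* ℂ) (ℓ : ℕ)
      (d : KolyvaginHeegnerData Dt β ι ℓ),
      ℓ.Prime ∧ Zhang2014.IsKolyvaginPrime (W.conductorNorm ℤ) W K p ℓ ∧
        d.kolyvaginClass hp.out 1 ≠ 0) ↔
    (W.mordellWeilRank = 2 ∧
      (W.sha ⊓ AddSubgroup.torsionBy W.galH1 (p : ℤ) : AddSubgroup W.galH1) = ⊥ ∧
      Nat.card ((W.quadraticTwist (NumberField.discr K : ℚ)).selmerGroup p) ≤ p) := by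
  constructor
  · rintro ⟨Dt, β, ι, ℓ, d, hℓ, hkol, hne⟩
    have hr2 := rank_eq_two_of_kolyvaginClass_prime_ne_zero h372 W hcm hr p h5 htower hKN K hK hD3 hD4
      hH hℓ hkol d hne
    exact ⟨hr2, (kolyvaginClass_prime_ne_zero_iff_shaTrivial_twistSelmer_of_rank_two_of_lemma84 h372 h84
      W hcm p h5 hgood hord htower hKN hS1 hS2 K hK hD3 hD4 hpD hH hr2).mp ⟨Dt, β, ι, ℓ, d, hℓ, hkol, hne⟩⟩
  · rintro ⟨hr2, hsha, hSel⟩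
    exact (kolyvaginClass_prime_ne_zero_iff_shaTrivial_twistSelmer_of_rank_two_of_lemma84 h372 h84 W hcm
      p h5 hgood hord htower hKN hS1 hS2 K hK hD3 hD4 hpD hH hr2).mpr ⟨hsha, hSel⟩

end Summit.BirchSwinnertonDyer.BirchSwinnertonDyer.Theorems.KolyvaginDepthDoor

end
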